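import Summits.QuantumFields.YangMills.Theorems.BalabanUVNodesK0CompCofinalRadiiOfFixedRadiusGuarded

/-!
# K0⁷ — D-defB-1 LOCATED TO THE DECIMAL: the one-radius door's two PLAQUETTE-CLASS slots `hUk` ∕ `h11` cost, beyond the [15] texts, EXACTLY «the radius-`ε` problem over the plaquette
# class `bgReg(ε)` is SOLVABLE at regular data» (₈a G₈a-1) and «EVERY plaquette-class minimiser satisfies print's current clause, i.e. lies in [15] (2)'s class `𝔘_k(ε)`» ((9)–(10) for
# plaquette-class minimisers) — the UNIQUENESS half of `h11` is then the EU-text's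

Cell `pub-ymgap`, width seat `pub-ymgap-dag-n07-w3` (g21; N07 [B11] ∕ K0⁷ junction).  `--kind proof --supports stmt-QuantumFields-20541 --as helper`, COUNT-NEUTRAL.  NEW leaf; theorems
only — 0 `def`, 0 `sorry`, 0 `instance`, 0 `notation`.  Imports ONLY this seat's `…K0CompCofinalRadiiOfFixedRadiusGuarded` (✓p796681; through it g20's (T1) socket
`…K0TopSocketOfThm1EUText`).  [I] = [Balaban1987RG1]; [15] = [Balaban1985Variational]; [III] = [Balaban1988Convergent].

WHY (g20's LOCATED D-defB-1, `RADIUS-COLLAPSE-DOOR-BILL.g20.md` §LOCATED, first obstruction).  After ✓p796681 the one-radius door's [15]-side bill is the EU-text + `hUk` ∕ `h11` ∕ `hLip` inside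
the level guard.  `hUk` (₈a's rows: `UkExists … ε V ∧ InUkClassB11 … ε (Uk … ε V)`) and `h11` ([I] (1.1): `UkExists … ε V ∧ UniqueUkOrbit … ε V`) are keyed on node00-def-B's PLAQUETTE-ONLY
class `bgReg` (D-defB-1: the current clause of [I] (1.2) dropped from the minimisation class), so neither follows from the texts, which speak of print's class (2) = `InUkClassB11` (plaquette
AND current clause).  THIS FILE isolates what the plaquette keying costs:
* §1 ★ `uniqueUkOrbit_of_orbitUnique_of_reg10` (generic, every `N`): if any two minimisers over `𝔘_k(ε)` at `V` are `OrbitRel k`-related (the EU-text's uniqueness clause at `(K, k, ε, V)`)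
  and EVERY minimiser over `bgReg(ε)` at `V` lies in `𝔘_k(ε)` (row (R10): (9)–(10) for plaquette-class minimisers), then `UniqueUkOrbit F N K k ε V` — a plaquette-class minimiser in
  `𝔘_k(ε) ⊆ bgReg(ε)` minimises over `𝔘_k(ε)` (`isBackground_of_subset_of_mem`, `InUkClassB11.mem_bgReg`).  ★ `hUk_of_ukExists_of_reg10`: ₈a's rows from G₈a-1 + (R10) (the chosen
  minimiser `Uk` IS a plaquette-class minimiser).
* §2 ★★ `h11_guarded_of_texts_of_ukExists_of_reg10` — INSIDE the guard `k + max c₀ c₁ ≤ F.m + K`, for radii `ε ∈ [ā, a₀]` and data on `PlaqSmall δ₁₁` (`0 < δ₁₁ ≤ min a₁ (a₀∕B₃)`,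
  `B₃δ₁₁ ≤ ā`): `h11` from the EU-text (levels `k ≥ 1`: g20's `exists_unique_isBackground_inUkClassB11_of_thm1EUSepCoP7MG`; level `0`: both minimisers are the datum) + G₈a-1 + (R10);
  ★★ `hUk_guarded_of_ukExists_of_reg10` (the door's `hUk` binder shape).
* §3 ★★★ `k0CompCofinalRadii_clause_of_texts_of_ukExists_of_reg10` — ✓p796681's `k0CompCofinalRadii_clause_of_texts_of_compAtFixedRadius` with `hUk` ∕ `h11` REPLACED by G₈a-1 (`hEx`:
  solvability over `bgReg(ε)` at `δ`-regular data, radii `[ā, a₀]`, inside the guard) and (R10) (`hR10`, same range): door (κ_cof)'s `F`-clause from the two texts + `hEx` + `hR10` + `hLip` +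
  continuity rows + numerics + the one-radius comparability letter.  So D-defB-1's price on the K0 road is EXACTLY {G₈a-1, (R10)} — both statements about the PLAQUETTE-class problem that
  print never poses ([I] (1.2) minimises over (2)); were `Uk` keyed on `InUkClassB11` (def-B's call), `hEx` would be the EU-text's existence clause and `hR10` vacuous.

HONEST FRAMING (binding).  Order-theoretic bookkeeping + by-name composition; NO β estimate; nothing of Bałaban's asserted or discharged.  DISPLAYED and inhabited nowhere: EU-text, G₈a-1
(`hEx`), (R10) (`hR10`), `hLip`, the continuity rows, the one-radius comparability letter (NODE O).  Stub 2′ OPEN; K0⁷ stmt-QuantumFields-20541 NOT closed; N07 NOT discharged; COUNT 8∕28 ·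
K 1∕4 UNMOVED; R4 = the CONDITIONAL finite-𝕋⁴ rung `BalabanLadder.UV` at fixed `ε = L^(−K)` only — NOT continuum ∕ ℝ⁴ ∕ OS; the Yang–Mills mass gap (Clay) is NOT proved by any of this.
Standard axioms only.
-/

noncomputable section

open MeasureTheory Set Filter Topology
open scoped Matrix.Norms.L2Operator

namespace Summit.QuantumFields.YangMills.BalabanUVNodes.K0PlaquetteClassSlotsOfTexts

open Literature.MathematicalPhysics.QuantumFieldTheory.Balaban1983to89
open Literature.MathematicalPhysics.QuantumFieldTheory.Balaban1983to89.Node00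
open Literature.MathematicalPhysics.QuantumFieldTheory.Balaban1983to89.T4Continuum
open Literature.MathematicalPhysics.QuantumFieldTheory.Balaban1983to89.FlowStep
open Literature.MathematicalPhysics.QuantumFieldTheory.Balaban1983to89.B15DeterminingSets
open Literature.MathematicalPhysics.QuantumFieldTheory.Balaban1983to89.ExpMeanLog (deltaSU deltaSU_pos)
open Literature.MathematicalPhysics.QuantumFieldTheory.Balaban1983to89.B12GaugeOrbits021 (OrbitRel)
open Literature.MathematicalPhysics.QuantumFieldTheory.Balaban1983to89.B11Thm1LevelZero (isBackground_zero_iff)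
open Literature.MathematicalPhysics.QuantumFieldTheory.Balaban1983to89.B11Thm1CarrierT (isBackground_of_subset_of_mem)
open Literature.MathematicalPhysics.QuantumFieldTheory.Balaban1983to89.B11Thm1ExistsUniqueCoP7MG (VariationalThm1EUSepCoP7MG)
open B12Eq019ActionBody (integrand)
open Summit.QuantumFields.YangMills.BalabanUVNodes.K0TopSocketOfThm1EUText (exists_unique_isBackground_inUkClassB11_of_thm1EUSepCoP7MG)
open Summit.QuantumFields.YangMills.BalabanUVNodes.K0CompCofinalRadiiOfFixedRadiusGuarded (k0CompCofinalRadii_clause_of_texts_of_compAtFixedRadius)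

/-! ## §1  Plaquette-class uniqueness and ₈a's rows from orbit-uniqueness in class (2) + the regularity row (R10) -/

section Generic

variable {F : T4Family} {N : ℕ} [NeZero N]

/-- ★ **`UniqueUkOrbit` (PLAQUETTE class) FROM ORBIT-UNIQUENESS IN [15] (2)'s CLASS + (R10).**  If any two minimisers of the Wilson action over `𝔘_k(ε)` on the fibre of `V` are related by a
residual gauge transformation, and every minimiser over the plaquette class `bgReg(ε)` on that fibre lies in `𝔘_k(ε)`, then any two plaquette-class minimisers are `OrbitRel k`-related: each
lies in `𝔘_k(ε) ⊆ bgReg(ε)` and so minimises over `𝔘_k(ε)` too. [cite: Balaban1985Variational, Thm 1 (6),(9)–(10) pp.278–279; Balaban1987RG1, (1.1)–(1.2) p.260] -/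
theorem uniqueUkOrbit_of_orbitUnique_of_reg10 {K k : ℕ} {ε : ℝ} {V : GaugeField (F.P K) k (SU N)}
    (huniq : ∀ U₁ U₂ : GaugeField (F.P K) 0 (SU N), IsBackground (avOfRecord F N K) {U | InUkClassB11 F N K k ε U} k V U₁ →
      IsBackground (avOfRecord F N K) {U | InUkClassB11 F N K k ε U} k V U₂ → OrbitRel k U₁ U₂)
    (hR10 : ∀ U₁ : GaugeField (F.P K) 0 (SU N), IsBackground (avOfRecord F N K) (bgReg F N K k ε) k V U₁ → InUkClassB11 F N K k ε U₁) :
    UniqueUkOrbit F N K k ε V := by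
  have hsub : {U : GaugeField (F.P K) 0 (SU N) | InUkClassB11 F N K k ε U} ⊆ bgReg F N K k ε := fun U hU => InUkClassB11.mem_bgReg hU
  intro U₁ U₂ h₁ h₂
  exact huniq U₁ U₂ (isBackground_of_subset_of_mem h₁ hsub (hR10 U₁ h₁)) (isBackground_of_subset_of_mem h₂ hsub (hR10 U₂ h₂))

/-- ★ **₈a's ROWS FROM G₈a-1 + (R10)**: if the plaquette-class problem at radius `ε` is solvable at `V` and every plaquette-class minimiser lies in `𝔘_k(ε)`, then in particular the minimiser of
record `U_k(ε; V)` does. [cite: Balaban1987RG1, (1.1)–(1.2) p.260, (0.21) p.256; Balaban1985Variational, Thm 1 (9)–(10) p.279] -/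
theorem hUk_of_ukExists_of_reg10 {K k : ℕ} {ε : ℝ} {V : GaugeField (F.P K) k (SU N)} (hex : UkExists F N K k ε V)
    (hR10 : ∀ U₁ : GaugeField (F.P K) 0 (SU N), IsBackground (avOfRecord F N K) (bgReg F N K k ε) k V U₁ → InUkClassB11 F N K k ε U₁) :
    UkExists F N K k ε V ∧ InUkClassB11 F N K k ε (Uk F N K k ε V) :=
  ⟨hex, hR10 _ (isBackground_Uk hex)⟩

end Generic

/-! ## §2  The door's `hUk` ∕ `h11` binders INSIDE the level guard from the EU-text + G₈a-1 + (R10) -/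

section Guarded

variable (F : T4Family) {N : ℕ} [NeZero N]

/-- ★★ **THE DOOR's `h11` BINDER INSIDE THE GUARD FROM THE EU-TEXT + G₈a-1 + (R10).**  Texts' letters `(c, c₀, c₁, B₃ ≥ 0, a₀, a₁)`; door radius `ā`, threshold `0 < δ₁₁ ≤ min a₁ (a₀∕B₃)` with
`B₃δ₁₁ ≤ ā`.  DISPLAYED: the EU-text; `hEx` (G₈a-1: solvability of the plaquette-class problem at radii `ε ∈ [ā, a₀]` for `δ₁₁`-regular data, inside the guard); `hR10` ((R10) there).  THEN for
every guarded member, radius `ε ∈ [ā, a₀]` and `δ₁₁`-regular `V`: `UkExists ∧ UniqueUkOrbit` at `(K, k, ε, V)` — levels `k ≥ 1` by g20's EU socket + §1, level `0` directly (both minimisers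
are the datum).  CONDITIONAL; nothing of Bałaban's asserted. [cite: Balaban1985Variational, Thm 1 (6),(8)–(10) pp.278–279; Balaban1987RG1, (1.1)–(1.2) p.260; Balaban1988Convergent, (2.12) p.256] -/
theorem h11_guarded_of_texts_of_ukExists_of_reg10 {c c₀ c₁ : ℕ} {B₃ a₀ a₁ ā δ₁₁ : ℝ} (hB₃ : 0 ≤ B₃)
    (hEU : VariationalThm1EUSepCoP7MG F N
      (fun ν M g K k _s => c ≤ ν.M₁ ∧ k + c₀ ≤ F.m + K ∧ F.L ^ c₁ ∣ M ∧
        ∀ i, 1 ≤ i → i ≤ k → dCubeSide (F.P K).L M (RkOfRecord (F.P K).L ν.r (g i)) i ∣ (F.P K).sitesPerDir 0) B₃ a₀ a₁)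
    (hδ₁₁ : 0 < δ₁₁) (hδα₁ : δ₁₁ ≤ min a₁ (a₀ / B₃)) (hBδ : B₃ * δ₁₁ ≤ ā)
    (hEx : ∀ (K k : ℕ), k + max c₀ c₁ ≤ F.m + K → ∀ ε : ℝ, ā ≤ ε → ε ≤ a₀ → ∀ V : GaugeField (F.P K) k (SU N), PlaqSmall δ₁₁ V → UkExists F N K k ε V)
    (hR10 : ∀ (K k : ℕ), k + max c₀ c₁ ≤ F.m + K → ∀ ε : ℝ, ā ≤ ε → ε ≤ a₀ → ∀ V : GaugeField (F.P K) k (SU N), PlaqSmall δ₁₁ V →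
      ∀ U₁ : GaugeField (F.P K) 0 (SU N), IsBackground (avOfRecord F N K) (bgReg F N K k ε) k V U₁ → InUkClassB11 F N K k ε U₁) :
    ∀ (K k : ℕ), k + max c₀ c₁ ≤ F.m + K → ∀ ε : ℝ, ā ≤ ε → ε ≤ a₀ → ∀ V : GaugeField (F.P K) k (SU N), PlaqSmall δ₁₁ V →
      UkExists F N K k ε V ∧ UniqueUkOrbit F N K k ε V := by
  intro K k hG ε hāε hεa₀ V hV
  refine ⟨hEx K k hG ε hāε hεa₀ V hV, ?_⟩
  rcases Nat.eq_zero_or_pos k with rfl | hk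
  · -- level `0`: both minimisers are the datum
    intro U₁ U₂ h₁ h₂
    obtain ⟨hU₁, -⟩ := (isBackground_zero_iff _ _ V U₁).1 h₁
    obtain ⟨hU₂, -⟩ := (isBackground_zero_iff _ _ V U₂).1 h₂
    subst hU₁ hU₂
    exact OrbitRel.refl 0 _
  · have hc₀ : k + c₀ ≤ F.m + K := le_trans (Nat.add_le_add_left (le_max_left c₀ c₁) k) hG
    have hc₁ : k + c₁ ≤ F.m + K := le_trans (Nat.add_le_add_left (le_max_right c₀ c₁) k) hG
    have hδa : δ₁₁ ≤ a₁ := hδα₁.trans (min_le_left _ _)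
    have hBε : B₃ * δ₁₁ ≤ ε := hBδ.trans hāε
    exact uniqueUkOrbit_of_orbitUnique_of_reg10
      (exists_unique_isBackground_inUkClassB11_of_thm1EUSepCoP7MG F N hB₃ hEU hk hc₀ hc₁ hδ₁₁ hδa hBε hεa₀ hV).2 (hR10 K k hG ε hāε hεa₀ V hV)

/-- ★★ **THE DOOR's `hUk` BINDER INSIDE THE GUARD FROM G₈a-1 + (R10)** (radii `ε ∈ [ā, a₀]`, `δ`-regular data with `0 < δ ≤ min a₁ (a₀∕B₃)` and `B₃δ ≤ ε`; the rows are asked for such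
`δ`). [cite: Balaban1987RG1, (1.1)–(1.2) p.260, (0.21) p.256; Balaban1985Variational, Thm 1 (9)–(10) p.279] -/
theorem hUk_guarded_of_ukExists_of_reg10 {c₀ c₁ : ℕ} {B₃ a₀ a₁ ā : ℝ}
    (hEx : ∀ (K k : ℕ), k + max c₀ c₁ ≤ F.m + K → ∀ ε : ℝ, ā ≤ ε → ε ≤ a₀ → ∀ (V : GaugeField (F.P K) k (SU N)) (δ : ℝ), 0 < δ → δ ≤ min a₁ (a₀ / B₃) → B₃ * δ ≤ ε →
      PlaqSmall δ V → UkExists F N K k ε V)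
    (hR10 : ∀ (K k : ℕ), k + max c₀ c₁ ≤ F.m + K → ∀ ε : ℝ, ā ≤ ε → ε ≤ a₀ → ∀ (V : GaugeField (F.P K) k (SU N)) (δ : ℝ), 0 < δ → δ ≤ min a₁ (a₀ / B₃) → B₃ * δ ≤ ε →
      PlaqSmall δ V → ∀ U₁ : GaugeField (F.P K) 0 (SU N), IsBackground (avOfRecord F N K) (bgReg F N K k ε) k V U₁ → InUkClassB11 F N K k ε U₁) :
    ∀ (K k : ℕ), k + max c₀ c₁ ≤ F.m + K → ∀ ε : ℝ, ā ≤ ε → ε ≤ a₀ → ∀ (V : GaugeField (F.P K) k (SU N)) (δ : ℝ), 0 < δ → δ ≤ min a₁ (a₀ / B₃) → B₃ * δ ≤ ε →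
      PlaqSmall δ V → UkExists F N K k ε V ∧ InUkClassB11 F N K k ε (Uk F N K k ε V) :=
  fun K k hG ε hāε hεa₀ V δ hδ hδa hBδ hV =>
    hUk_of_ukExists_of_reg10 (hEx K k hG ε hāε hεa₀ V δ hδ hδa hBδ hV) (hR10 K k hG ε hāε hεa₀ V δ hδ hδa hBδ hV)

end Guarded

/-! ## §3  The one-radius door with the plaquette-class slots re-keyed: D-defB-1's price = {G₈a-1, (R10)} -/

section Door

variable (F : T4Family)

/-- ★★★ **DOOR (κ_cof)'s `F`-CLAUSE FROM THE TWO [15] TEXTS + G₈a-1 + (R10) + `hLip` + CONTINUITY + NUMERICS + THE ONE-RADIUS COMPARABILITY LETTER** — ✓p796681's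
`k0CompCofinalRadii_clause_of_texts_of_compAtFixedRadius` with its plaquette-class slots `hUk` ∕ `h11` REPLACED by `hEx` (G₈a-1: the radius-`ε` problem over `bgReg(ε)` is solvable at
`δ`-regular data, `0 < δ ≤ min a₁ (a₀∕B₃)`, `B₃δ ≤ ε`, radii `ε ∈ [ā, a₀]`, inside the guard) and `hR10` ((R10): every such plaquette-class minimiser lies in [15] (2)'s class `𝔘_k(ε)`).  D-defB-1's
price on this road is therefore EXACTLY these two plaquette-class sentences; the uniqueness half of (1.1) is the EU-text's.  CONDITIONAL on every displayed row; NO β estimate; nothing of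
Bałaban's asserted; K0⁷ NOT closed. [cite: Balaban1985Variational, Thm 1 (6),(8)–(10) pp.278–279, Prop. 9 p.309; Balaban1987RG1, Thm 3 p.264, §1 p.264, (0.20) p.256, (1.1)–(1.2) p.260, (1.20)–(1.22) p.264, (2.9) p.266 and p.267; Balaban1988Convergent, (2.6)–(2.8) pp.255–256, (2.12) p.256; Balaban1985Averaging, Prop. 2 (53) p.26 (bookkeeping)] -/
theorem k0CompCofinalRadii_clause_of_texts_of_ukExists_of_reg10 {c c₀ c₁ : ℕ} {B₃ a₀ a₁ : ℝ} (hB₃ : 7 ≤ B₃)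
    (h15 : VariationalThm1RegSepCoP7MGB F 2
      (fun ν M g K k _s => c ≤ ν.M₁ ∧ k + c₀ ≤ F.m + K ∧ F.L ^ c₁ ∣ M ∧
        ∀ i, 1 ≤ i → i ≤ k → dCubeSide (F.P K).L M (RkOfRecord (F.P K).L ν.r (g i)) i ∣ (F.P K).sitesPerDir 0) (lamDatum F) (dataSmall7LamTopOf F 2) B₃ a₀ a₁)
    (hEU : VariationalThm1EUSepCoP7MG F 2
      (fun ν M g K k _s => c ≤ ν.M₁ ∧ k + c₀ ≤ F.m + K ∧ F.L ^ c₁ ∣ M ∧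
        ∀ i, 1 ≤ i → i ≤ k → dCubeSide (F.P K).L M (RkOfRecord (F.P K).L ν.r (g i)) i ∣ (F.P K).sitesPerDir 0) B₃ a₀ a₁)
    (ā δ₁₁ α tL rL BL εmax : ℝ) (hā : 0 < ā) (hāα₀ : ā < a₀) (hBL : 0 ≤ BL)
    (hδ₁₁ : 0 < δ₁₁) (hδα₁ : δ₁₁ ≤ min a₁ (a₀ / B₃)) (hBδ : B₃ * δ₁₁ ≤ ā)
    (hāα : ā < α) (hα3 : 143 * 256 * α ≤ 1 / 3) (hα2 : 2 * α ≤ 2 * deltaSU (Fin 2) / (8 * (F.L : ℝ)) ^ 2)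
    (hα24 : 9 * (F.L : ℝ) ^ 2 * (2 * α) ≤ 1 / 24) (hαL : 157 * (9 * (F.L : ℝ) ^ 2 * (2 * α)) < ((F.L : ℝ) ^ 3)⁻¹)
    (hεmax : 0 < εmax)
    (hε53a : 143 * 256 * ((80 * BL * (F.L : ℝ) ^ 4 + 1) * εmax) ≤ 1 / 3)
    (hε53b : 2 * ((80 * BL * (F.L : ℝ) ^ 4 + 1) * εmax) ≤ 2 * deltaSU (Fin 2) / (8 * (F.L : ℝ)) ^ 2)
    (hεδ : 2 * ((80 * BL * (F.L : ℝ) ^ 4 + 1) * εmax) ≤ δ₁₁) (hεα₁ : 2 * ((80 * BL * (F.L : ℝ) ^ 4 + 1) * εmax) ≤ min a₁ (a₀ / B₃))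
    (hεB : 2 * B₃ * ((80 * BL * (F.L : ℝ) ^ 4 + 1) * εmax) ≤ ā)
    (hεn1 : 1640 * (12 * (F.L : ℝ) * εmax + 18 * ā) * (F.L : ℝ) ^ 6 ≤ 1) (hεn2 : 13 * (12 * (F.L : ℝ) * εmax + 18 * ā) * (F.L : ℝ) ^ 3 < deltaSU (Fin 2))
    (hεtL : 60 * (F.L : ℝ) ^ 4 * εmax ≤ tL) (hεrL : (80 * BL * (F.L : ℝ) ^ 4 + 1) * εmax / (F.L : ℝ) ^ 2 ≤ rL)
    (hEx : ∀ (K k : ℕ), k + max c₀ c₁ ≤ F.m + K → ∀ ε : ℝ, ā ≤ ε → ε ≤ a₀ → ∀ (V : GaugeField (F.P K) k (Node00.SU 2)) (δ : ℝ), 0 < δ → δ ≤ min a₁ (a₀ / B₃) → B₃ * δ ≤ ε →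
      PlaqSmall δ V → UkExists F 2 K k ε V)
    (hR10 : ∀ (K k : ℕ), k + max c₀ c₁ ≤ F.m + K → ∀ ε : ℝ, ā ≤ ε → ε ≤ a₀ → ∀ (V : GaugeField (F.P K) k (Node00.SU 2)) (δ : ℝ), 0 < δ → δ ≤ min a₁ (a₀ / B₃) → B₃ * δ ≤ ε →
      PlaqSmall δ V → ∀ U₁ : GaugeField (F.P K) 0 (Node00.SU 2), IsBackground (avOfRecord F 2 K) (bgReg F 2 K k ε) k V U₁ → InUkClassB11 F 2 K k ε U₁)
    (hLip : ∀ (K k : ℕ), k + max c₀ c₁ ≤ F.m + K → ∀ (V V' : GaugeField (F.P K) k (Node00.SU 2)) (t r : ℝ), 0 ≤ t → t ≤ tL → 0 < r → r ≤ rL →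
      (∀ b, dist1 ((V' b)⁻¹ * V b) ≤ t) →
      (UkExists F 2 K k ā V' ∧ ∀ U₁, IsBackground (avOfRecord F 2 K) (bgReg F 2 K k ā) k V' U₁ → U₁ ∈ bgReg F 2 K k r) →
      (UkExists F 2 K k ā V ∧ ∀ U₁, IsBackground (avOfRecord F 2 K) (bgReg F 2 K k ā) k V U₁ → U₁ ∈ bgReg F 2 K k (r + BL * t)))
    (hcomp : ∀ ε₂₉ : ℝ, 0 < ε₂₉ → ε₂₉ ≤ εmax → ∃ γ₀ : ℝ, 0 < γ₀ ∧
      ∀ (n : ℕ) (gs : ℕ → ℝ), RGEqH n (betaOfRecord₁₃ F 2 (theta13OfThm1CCMWZB F 2 0 (1 / 2) ā 0 ε₂₉ 0 0 ā 0 (fun _ _ => 0) (fun _ _ => 0))) gs →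
        Step.InInterval γ₀ n gs → ∀ m, m < n → gs m ≤ 2 * gs (m + 1) ∧ gs (m + 1) ≤ 2 * gs m)
    (hT : ∀ ε₂₉ : ℝ, 0 < ε₂₉ → ε₂₉ ≤ εmax → ∀ K (g : ℕ → ℝ) k, k < K → k + 1 + max c₀ c₁ ≤ F.m + K →
      {V : GaugeField (F.P K) (k + 1) (Node00.SU 2) | PlaqSmall δ₁₁ V} ⊆ regSetOfRecord F 2 K k
        (integrand (chiFixed29 F 2 (numerics7OfThm1CCM F.L 0 0 0 0 ā 0) ε₂₉ K g k) (gfOfRecord F 2 K k) (g k)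
          (effActionHT F 2 (TcanOfRecord F 2) (chiFixed29 F 2 (numerics7OfThm1CCM F.L 0 0 0 0 ā 0) ε₂₉) K g k))) :
    ∀ a : ℝ, 0 < a → ∃ a' : ℝ, 0 < a' ∧ a' ≤ a ∧
      ∃ (γ₀ ε₂₉ : ℝ) (j : ℕ) (ε₀ B₃'' B₃' a₁' : ℝ) (Efl logz : B12.RunParams → ℕ → ℝ), 0 < γ₀ ∧ 0 < ε₂₉ ∧
        ∀ (n : ℕ) (gs : ℕ → ℝ), RGEqH n (betaOfRecord₁₃ F 2 (theta13OfThm1CCMWZB F 2 j (1 / 2) a' ε₀ ε₂₉ B₃'' B₃' a' a₁' Efl logz)) gs → Step.InInterval γ₀ n gs →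
          ∀ m, m < n → gs m ≤ 2 * gs (m + 1) ∧ gs (m + 1) ≤ 2 * gs m := by
  have hB₃0 : 0 ≤ B₃ := by linarith
  refine k0CompCofinalRadii_clause_of_texts_of_compAtFixedRadius F hB₃ h15 hEU ā δ₁₁ α tL rL BL εmax hā hāα₀ hBL hδ₁₁ hδα₁ hBδ hāα hα3 hα2 hα24 hαL hεmax hε53a hε53b
    hεδ hεα₁ hεB hεn1 hεn2 hεtL hεrL (hUk_guarded_of_ukExists_of_reg10 F hEx hR10) ?_ hLip hcomp hT
  -- `h11` on `PlaqSmall δ₁₁` from the EU-text + G₈a-1 + (R10) at `δ := δ₁₁`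
  exact h11_guarded_of_texts_of_ukExists_of_reg10 F hB₃0 hEU hδ₁₁ hδα₁ hBδ
    (fun K k hG ε hāε hεa₀ V hV => hEx K k hG ε hāε hεa₀ V δ₁₁ hδ₁₁ hδα₁ (hBδ.trans hāε) hV)
    (fun K k hG ε hāε hεa₀ V hV => hR10 K k hG ε hāε hεa₀ V δ₁₁ hδ₁₁ hδα₁ (hBδ.trans hāε) hV)

end Door

end Summit.QuantumFields.YangMills.BalabanUVNodes.K0PlaquetteClassSlotsOfTexts
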